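import Summits.CriticalPhenomena.CardyFormulaZ2.Theses.CardyBoundaryCoulombGas
import Literature.Probability.LatticeModels.RowStatePlanar
import Literature.Probability.Percolation.LatticeSymmetry
import Literature.Probability.Percolation.PlanarDuality
import Literature.Probability.Percolation.RussoFormula

/-!
# Two-cluster dictionary, counting formula: reading the bonds of a rectangle as a chain trajectory

Helper file for the stub `stub_twoClusterDictionary` (D3) of the line
`two-cluster-rate-is-stationary-gap` of crux `CardyBoundaryCoulombGas.StripClusterRates`
(stmt-CriticalPhenomena-13878).

The `⋆`-chain of `PercolationRowTransfer.lean` / `RowStatePlanar.lean` on the column sites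
`S = {0,…,n}` is driven by admissible bond sequences `seq : Fin m → Finset S × Finset S`,
`seq t = (O_t, H_t)` with `H_t ⊆ hEdges S`, of total number `(2^{|S|} 2^{|hEdges S|})^m`. Reading a
bond configuration `ω` of `ℤ²` along the rectangle `[0,m] × [0,n]` — `O_t(ω)` = the open horizontal
edges `{(t,y),(t+1,y)}`, `H_t(ω)` = the open vertical edges `{(t+1,y),(t+1,y+1)}` — is a bijection
between the configurations of these `m(2n+1)` edges and the admissible sequences, so that under
`P_{1/2}` (`bondPercolation (zdGraph 2) half`) the probability that the read sequence satisfies a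
property is the normalised COUNT of admissible sequences with that property (`d3_count`).

Sources: Grimmett, *Percolation* (1999), §1.3 (product measure), §2.2 (cylinder events); the
normalisation is that of `PercolationRowTransfer` (Bondesan–Jacobsen–Saleur 2013, §2).
-/

noncomputable section

namespace Summit.CriticalPhenomena.CardyFormulaZ2.Cruxes.StripClusterRates.TwoClusterRateIsStationaryGap

open Filter Topology
open scoped BigOperators Classical
open Literature.Probability.Percolation Literature.Probability.LatticeModels

/-- Horizontal lattice edges `{(a,y),(a+1,y)}` are pairwise distinct. -/
theorem d3_hEdge_inj {a b y y' : ℤ}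
    (h : (s(![a, y], ![a + 1, y]) : Sym2 (Site 2)) = s(![b, y'], ![b + 1, y'])) : a = b ∧ y = y' := by
  rw [Sym2.eq_iff] at h
  rcases h with ⟨h1, -⟩ | ⟨h1, h2⟩
  · have e0 := congr_fun h1 0
    have e1 := congr_fun h1 1
    simp at e0 e1
    exact ⟨e0, e1⟩
  · have e0 := congr_fun h1 0
    have f0 := congr_fun h2 0
    simp at e0 f0
    omega

/-- Vertical lattice edges `{(a,y),(a,y+1)}` are pairwise distinct. -/
theorem d3_vEdge_inj {a b y y' : ℤ}
    (h : (s(![a, y], ![a, y + 1]) : Sym2 (Site 2)) = s(![b, y'], ![b, y' + 1])) : a = b ∧ y = y' := by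
  rw [Sym2.eq_iff] at h
  rcases h with ⟨h1, -⟩ | ⟨h1, h2⟩
  · have e0 := congr_fun h1 0
    have e1 := congr_fun h1 1
    simp at e0 e1
    exact ⟨e0, e1⟩
  · have e1 := congr_fun h1 1
    have f1 := congr_fun h2 1
    simp at e1 f1
    omega

/-- A horizontal lattice edge is not a vertical one. -/
theorem d3_hEdge_ne_vEdge {a b y y' : ℤ} :
    (s(![a, y], ![a + 1, y]) : Sym2 (Site 2)) ≠ s(![b, y'], ![b, y' + 1]) := by
  intro h
  rw [Sym2.eq_iff] at h
  rcases h with ⟨h1, h2⟩ | ⟨h1, h2⟩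
  · have e0 := congr_fun h1 0
    have f0 := congr_fun h2 0
    simp at e0 f0
    omega
  · have e0 := congr_fun h1 0
    have f0 := congr_fun h2 0
    simp at e0 f0
    omega

/-- **Counting formula.** Under `P_{1/2}` on `ℤ²`, the probability that the bond sequence read off the
rectangle `[0,m] × [0,n]` (`O_t` = open horizontal edges between columns `t`, `t+1`; `H_t` = open
vertical edges of column `t+1`) has a property `pred` is the number of admissible sequences with that
property divided by `(2^{n+1} 2^{n})^m`. -/
theorem d3_count : ∀ (n m : ℕ)
    (pred : (Fin m → Finset (Finset.Icc (0 : ℤ) n) × Finset (Finset.Icc (0 : ℤ) n)) → Prop)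
    [DecidablePred pred],
    (bondPercolation (zdGraph 2) half).real {ω | pred fun i : Fin m =>
        (Finset.univ.filter fun y : Finset.Icc (0 : ℤ) n =>
            s(![((i : ℕ) : ℤ), (y : ℤ)], ![((i : ℕ) : ℤ) + 1, (y : ℤ)]) ∈ ω,
          (hEdges (Finset.Icc (0 : ℤ) n)).filter fun y =>
            s(![((i : ℕ) : ℤ) + 1, (y : ℤ)], ![((i : ℕ) : ℤ) + 1, (y : ℤ) + 1]) ∈ ω)} =
      (((Fintype.piFinset fun _ : Fin m => (Finset.univ : Finset (Finset (Finset.Icc (0 : ℤ) n))) ×ˢ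
          (hEdges (Finset.Icc (0 : ℤ) n)).powerset).filter pred).card : ℝ) /
        ((2 : ℝ) ^ (Finset.Icc (0 : ℤ) n).card * 2 ^ (hEdges (Finset.Icc (0 : ℤ) n)).card) ^ m := by
  intro n m pred _
  -- the edge read by the bond `y ∈ O_t` / `y ∈ H_t`
  set hE : Fin m → Finset.Icc (0 : ℤ) n → Sym2 (Site 2) :=
    fun i y => s(![((i : ℕ) : ℤ), (y : ℤ)], ![((i : ℕ) : ℤ) + 1, (y : ℤ)]) with hhE
  set vE : Fin m → Finset.Icc (0 : ℤ) n → Sym2 (Site 2) :=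
    fun i y => s(![((i : ℕ) : ℤ) + 1, (y : ℤ)], ![((i : ℕ) : ℤ) + 1, (y : ℤ) + 1]) with hvE
  set seqOf : BondConfig (Site 2) → Fin m → Finset (Finset.Icc (0 : ℤ) n) × Finset (Finset.Icc (0 : ℤ) n) :=
    fun ω i => (Finset.univ.filter fun y => hE i y ∈ ω,
      (hEdges (Finset.Icc (0 : ℤ) n)).filter fun y => vE i y ∈ ω) with hseqOf
  set edgesOf : (Fin m → Finset (Finset.Icc (0 : ℤ) n) × Finset (Finset.Icc (0 : ℤ) n)) →
      Finset (Sym2 (Site 2)) :=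
    fun seq => Finset.univ.biUnion fun i => (seq i).1.image (hE i) ∪ (seq i).2.image (vE i)
    with hedgesOf
  set E : Finset (Sym2 (Site 2)) := edgesOf fun _ => (Finset.univ, hEdges (Finset.Icc (0 : ℤ) n))
    with hEdef
  set seqs := Fintype.piFinset fun _ : Fin m =>
    (Finset.univ : Finset (Finset (Finset.Icc (0 : ℤ) n))) ×ˢ (hEdges (Finset.Icc (0 : ℤ) n)).powerset
    with hseqs
  change (bondPercolation (zdGraph 2) half).real {ω | pred (seqOf ω)} = ((seqs.filter pred).card : ℝ) / _
  -- injectivity of the reading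
  have hE_inj : ∀ {i j y y'}, hE i y = hE j y' → i = j ∧ y = y' := by
    intro i j y y' h
    obtain ⟨h1, h2⟩ := d3_hEdge_inj h
    exact ⟨Fin.ext (by exact_mod_cast h1), Subtype.ext h2⟩
  have vE_inj : ∀ {i j y y'}, vE i y = vE j y' → i = j ∧ y = y' := by
    intro i j y y' h
    obtain ⟨h1, h2⟩ := d3_vEdge_inj h
    exact ⟨Fin.ext (by omega), Subtype.ext h2⟩
  have hE_ne_vE : ∀ {i j y y'}, hE i y ≠ vE j y' := fun h => d3_hEdge_ne_vEdge h
  have mem_edgesOf : ∀ seq e, e ∈ edgesOf seq ↔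
      ∃ i, (∃ y ∈ (seq i).1, hE i y = e) ∨ ∃ y ∈ (seq i).2, vE i y = e := by
    intro seq e
    simp [hedgesOf]
  have hE_mem : ∀ seq i y, hE i y ∈ edgesOf seq ↔ y ∈ (seq i).1 := by
    intro seq i y
    rw [mem_edgesOf]
    constructor
    · rintro ⟨j, ⟨y', hy', h⟩ | ⟨y', -, h⟩⟩
      · obtain ⟨rfl, rfl⟩ := hE_inj h
        exact hy'
      · exact absurd h.symm hE_ne_vE
    · exact fun h => ⟨i, Or.inl ⟨y, h, rfl⟩⟩
  have vE_mem : ∀ seq i y, vE i y ∈ edgesOf seq ↔ y ∈ (seq i).2 := by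
    intro seq i y
    rw [mem_edgesOf]
    constructor
    · rintro ⟨j, ⟨y', -, h⟩ | ⟨y', hy', h⟩⟩
      · exact absurd h hE_ne_vE
      · obtain ⟨rfl, rfl⟩ := vE_inj h
        exact hy'
    · exact fun h => ⟨i, Or.inr ⟨y, h, rfl⟩⟩
  have hE_E : ∀ i y, hE i y ∈ E := fun i y => (hE_mem _ i y).2 (Finset.mem_univ y)
  have vE_E : ∀ i y, y ∈ hEdges (Finset.Icc (0 : ℤ) n) → vE i y ∈ E := fun i y hy => (vE_mem _ i y).2 hy
  have mem_seqs : ∀ seq, seq ∈ seqs ↔ ∀ i, (seq i).2 ⊆ hEdges (Finset.Icc (0 : ℤ) n) := by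
    intro seq
    simp [hseqs, Fintype.mem_piFinset]
  -- the two readings are inverse to each other
  have seqOf_edgesOf : ∀ seq ∈ seqs, seqOf (↑(edgesOf seq) : Set (Sym2 (Site 2))) = seq := by
    intro seq hseq
    funext i
    refine Prod.ext ?_ ?_
    · ext y
      simp [hseqOf, hE_mem]
    · ext y
      simp only [hseqOf, Finset.mem_filter, Finset.mem_coe, vE_mem, and_iff_right_iff_imp]
      exact fun h => (mem_seqs seq).1 hseq i h
  have edgesOf_seqOf : ∀ T : Finset (Sym2 (Site 2)), T ⊆ E →
      edgesOf (seqOf (↑T : Set (Sym2 (Site 2)))) = T := by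
    intro T hT
    ext e
    rw [mem_edgesOf]
    constructor
    · rintro ⟨i, ⟨y, hy, rfl⟩ | ⟨y, hy, rfl⟩⟩
      · simpa [hseqOf] using hy
      · simp only [hseqOf, Finset.mem_filter, Finset.mem_coe] at hy
        exact hy.2
    · intro he
      obtain ⟨i, ⟨y, -, rfl⟩ | ⟨y, hy, rfl⟩⟩ := (mem_edgesOf _ e).1 (hT he)
      · exact ⟨i, Or.inl ⟨y, by simpa [hseqOf] using he, rfl⟩⟩
      · exact ⟨i, Or.inr ⟨y, by simp [hseqOf, hy, he], rfl⟩⟩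
  have seqOf_mem : ∀ ω, seqOf ω ∈ seqs := fun ω =>
    (mem_seqs _).2 fun i => Finset.filter_subset _ _
  have edgesOf_sub : ∀ seq ∈ seqs, edgesOf seq ⊆ E := by
    intro seq hseq e he
    obtain ⟨i, ⟨y, -, rfl⟩ | ⟨y, hy, rfl⟩⟩ := (mem_edgesOf _ e).1 he
    · exact hE_E i y
    · exact vE_E i y ((mem_seqs seq).1 hseq i hy)
  -- the event is a cylinder event over `E`
  have hdet : DeterminedBy {ω : BondConfig (Site 2) | pred (seqOf ω)} ↑E := by
    rw [determinedBy_iff]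
    intro ω ω' h
    have key : ∀ e ∈ E, e ∈ ω ↔ e ∈ ω' := fun e he =>
      ⟨fun h1 => ((Set.ext_iff.1 h e).1 ⟨h1, he⟩).1, fun h1 => ((Set.ext_iff.1 h e).2 ⟨h1, he⟩).1⟩
    have hs : seqOf ω = seqOf ω' := by
      funext i
      refine Prod.ext ?_ ?_
      · exact Finset.filter_congr fun y _ => key _ (hE_E i y)
      · exact Finset.filter_congr fun y hy => key _ (vE_E i y hy)
    simp only [Set.mem_setOf_eq, hs]
  have hEsub : (↑E : Set (Sym2 (Site 2))) ⊆ (zdGraph 2).edgeSet := by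
    intro e he
    obtain ⟨i, ⟨y, -, rfl⟩ | ⟨y, -, rfl⟩⟩ := (mem_edgesOf _ e).1 he
    · rw [SimpleGraph.mem_edgeSet, zdGraph_two_adj_iff]
      left
      simp
    · rw [SimpleGraph.mem_edgeSet, zdGraph_two_adj_iff]
      right; right; left
      simp
  -- counting: every cylinder over `E` has probability `2^{-|E|}`
  have hbij : ∀ (q : (Fin m → Finset (Finset.Icc (0 : ℤ) n) × Finset (Finset.Icc (0 : ℤ) n)) → Prop)
      [DecidablePred q], (E.powerset.filter fun T : Finset (Sym2 (Site 2)) =>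
        q (seqOf (↑T : Set (Sym2 (Site 2))))).card = (seqs.filter q).card := by
    intro q _
    refine Finset.card_nbij' (fun T : Finset (Sym2 (Site 2)) => seqOf (↑T : Set (Sym2 (Site 2)))) edgesOf
      (fun T hT => ?_) (fun seq hseq => ?_) (fun T hT => ?_) (fun seq hseq => ?_)
    · rw [Finset.mem_coe, Finset.mem_filter] at hT ⊢
      exact ⟨seqOf_mem _, hT.2⟩
    · rw [Finset.mem_coe, Finset.mem_filter] at hseq ⊢
      rw [Finset.mem_powerset, seqOf_edgesOf seq hseq.1]
      exact ⟨edgesOf_sub seq hseq.1, hseq.2⟩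
    · rw [Finset.mem_coe, Finset.mem_filter, Finset.mem_powerset] at hT
      exact edgesOf_seqOf T hT.1
    · rw [Finset.mem_coe, Finset.mem_filter] at hseq
      exact seqOf_edgesOf seq hseq.1
  have hcardE : (2 : ℝ) ^ E.card = ((2 : ℝ) ^ (Finset.Icc (0 : ℤ) n).card *
      2 ^ (hEdges (Finset.Icc (0 : ℤ) n)).card) ^ m := by
    have h1 : (E.powerset.filter fun T : Finset (Sym2 (Site 2)) =>
        (fun _ => True) (seqOf (↑T : Set (Sym2 (Site 2))))).card =
        (seqs.filter fun _ => True).card := hbij (fun _ => True)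
    simp only [Finset.filter_true] at h1
    have h2 : 2 ^ E.card = ((Finset.univ : Finset (Finset (Finset.Icc (0 : ℤ) n))) ×ˢ
        (hEdges (Finset.Icc (0 : ℤ) n)).powerset).card ^ m := by
      rw [← Finset.card_powerset, h1, hseqs, Fintype.card_piFinset, Finset.prod_const]
      simp
    rw [← card_univ_product_powerset]
    exact_mod_cast h2
  have hprob : (bondPercolation (zdGraph 2) half).real {ω | pred (seqOf ω)} =
      ((E.powerset.filter fun T : Finset (Sym2 (Site 2)) =>
        pred (seqOf (↑T : Set (Sym2 (Site 2))))).card : ℝ) * (1 / 2) ^ E.card := by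
    change (ProbabilityTheory.setBernoulli ((zdGraph 2).edgeSet) half).real _ = _
    rw [Russo.measureReal_eq_cylPoly hdet (zdGraph 2).edgeSet half, Russo.cylPoly]
    have hw : ∀ T ∈ E.powerset, ∏ i ∈ E, Russo.weight (zdGraph 2).edgeSet (↑T : Set (Sym2 (Site 2))) i
        ((half : unitInterval) : ℝ) = (1 / 2) ^ E.card := by
      intro T _
      rw [← Finset.prod_const]
      refine Finset.prod_congr rfl fun e he => ?_
      have heE : e ∈ (zdGraph 2).edgeSet := hEsub he
      by_cases heT : e ∈ (↑T : Set (Sym2 (Site 2)))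
      · simp [Russo.weight, heT, heE]
      · simp [Russo.weight, heT, heE]; norm_num
    trans ∑ T ∈ E.powerset, if pred (seqOf (↑T : Set (Sym2 (Site 2)))) then ((1 : ℝ) / 2) ^ E.card else 0
    · refine Finset.sum_congr rfl fun T hT => ?_
      have hiff : (↑T : Set (Sym2 (Site 2))) ∈ {ω : BondConfig (Site 2) | pred (seqOf ω)} ↔
          pred (seqOf (↑T : Set (Sym2 (Site 2)))) := Iff.rfl
      by_cases h : pred (seqOf (↑T : Set (Sym2 (Site 2))))
      · rw [if_pos h, if_pos (hiff.2 h), hw T hT]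
      · rw [if_neg h, if_neg (mt hiff.1 h)]
    rw [← Finset.sum_filter, Finset.sum_const, nsmul_eq_mul]
  rw [hprob, hbij pred, one_div_pow, hcardE, mul_one_div]

end Summit.CriticalPhenomena.CardyFormulaZ2.Cruxes.StripClusterRates.TwoClusterRateIsStationaryGap
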